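import Mathlib
import Summits.Ventures.PercRepro2.Defs
import Summits.Ventures.PercRepro2.Independence
import Summits.Ventures.PercRepro2.Harris
import Summits.Ventures.PercRepro2.Graph
import Summits.Ventures.PercRepro2.Exploration
import Summits.Ventures.PercRepro2.Events
import Summits.Ventures.PercRepro2.HCov
import Summits.Ventures.PercRepro2.HCovFns
import Summits.Ventures.PercRepro2.HCovSwap
import Summits.Ventures.PercRepro2.PendantRoot
import Summits.Ventures.PercRepro2.PendantO
import Summits.Ventures.PercRepro2.PendantB
import Summits.Ventures.PercRepro2.PendantBRow
import Summits.Ventures.PercRepro2.LeafStep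
import Summits.Ventures.PercRepro2.LeafStepT0

/-!
# The leaf row through the pole identity: `2′LEAF ⟸ (HCOV) ∧ (Q1)` at the attachment vertex, and
the leaf closure of `(HCOV) ∧ (Q1)` (blind cell PercRepro2, p1 g8; `proofs/P1-LEAFPLUS.md`)

For `a₃` a leaf at `v ∉ {o, b, a₁, a₂}` with weight `q`, `Gc(q) = (1−q)² T₀ + 2q(1−q) R½ + q² Gc(v)`
(`LeafStep.Gc_leaf`). Reading `Gc = D·X + D_o·Y` with `D = P(PD)`, `D_o = P(PD, o ∈ U)` and
`X, Y` the moment functionals — all four affine in `q` — and evaluating the quadratic at the pole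
`q* = P(Q)/P(Q, v ∈ U)` of `G = Gc/(D·P(Q))`, where `D(q*) = 0`, gives the EXACT IDENTITY

  **`2 · P(Q) · D_v · R½ = D_v² · T₀ + P(Q)² · Gc(v) + CovC(o, v) · T₀(b, v)`**   (`Rhalf_pole_identity`)

with `D_v = P(PD_v) = P(Q, v ∉ U)`, `CovC(o, v) = P(Q, o ∈ U, v ∈ U)·P(Q) − P(Q, o ∈ U)·P(Q, v ∈ U)`
(the cleared covariance of `1_{o∈U}`, `1_{v∈U}` under `P(·|Q)`) and `T₀(b, v)` the `a₃`-free
functional of the markers `(b, v)` (`= 2P(Z_L + Z_H)(b, v) ≥ 0`, `LeafStepT0.T0_nonneg`).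
Consequently:

* **`leafRow_of_Q1`**: if `D_v > 0`, the row `0 ≤ R½` (2′LEAF at `v`) follows from `0 ≤ T₀` and the
  quantitative row **`(Q1) := 0 ≤ P(Q)² · Gc(o, b, a₃) + CovC(o, a₃) · T₀(b, a₃)`** at `a₃ := v`
  (`Q1Row`; on `CovC ≥ 0` it is implied by (HCOV), on `CovC < 0` it strengthens (HCOV) by the
  margin `|CovC|·T₀(b, a₃)`; `CovC ≥ 0` is FALSE in general — `c6_00106` — so the margin is needed);
* the row propagates along leaves: `CovC(o, a₃) = q · CovC(o, v)` and `T₀(b, a₃) = q · T₀(b, v)`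
  (`covC_leaf`, `T0_leaf`), so **`HCovPlus := HCov ∧ Q1Row` is LEAF-CLOSED** (`HCovPlus_leaf`):
  `HCovPlus` at the marker `v` (with `D_v > 0`) gives `HCovPlus` at a leaf `a₃` attached to `v`,
  for every leaf weight — the leaf rung of the weighted line is settled modulo `HCovPlus` at the
  attachment vertex (census of `(Q1)`: 0 / 725,760 at `n = 6` FULL × 6 palettes, 0 / 2,320,920 at
  `n = 7`, `m ≤ 12`, own code `work/c/q1.c`).
The degenerate case `D_v = 0` (`v` pinned to a root) is excluded by hypothesis; there the leaf is
a pendant at that root.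
-/

namespace Summit.Ventures.PercRepro2

open UnionCluster CovForm PendantRoot PendantO

namespace LeafStep

variable {V : Type*} {E : Type*} [Fintype E] [DecidableEq E] [Fintype V] [DecidableEq V]
  {R : Type*} [Field R] [LinearOrder R] [IsStrictOrderedRing R]

section Defs

variable (p : E → R) (ends : E → Sym2 V)

/-- **`CovC(o, v)`** `= P(Q, o ∈ U, v ∈ U)·P(Q) − P(Q, o ∈ U)·P(Q, v ∈ U)`: the cleared covariance of
`1_{o ∈ U}` and `1_{v ∈ U}` under `P(·|Q)` (indefinite in general: `c6_00106`). -/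
noncomputable def covC (o a₁ a₂ v : V) : R :=
  mUU p ends o a₁ a₂ v * prob p (avoidAll ends a₂ {a₁}) - mU p ends a₁ a₂ o * mU p ends a₁ a₂ v

/-- **Row (Q1)**: `0 ≤ P(Q)² · Gc(o, b, a₃) + CovC(o, a₃) · T₀(b, a₃)` — the quantitative companion
of (HCOV) that the leaf step needs (equal to (HCOV) up to the margin `CovC(o, a₃) · T₀(b, a₃)`). -/
def Q1Row (o a₁ a₂ a₃ b : V) : Prop :=
  0 ≤ prob p (avoidAll ends a₂ {a₁}) ^ 2 * Gc p ends o a₁ a₂ a₃ b +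
    covC p ends o a₁ a₂ a₃ * T0 p ends b a₁ a₂ a₃

/-- **`(HCOV)⁺ := (HCOV) ∧ (Q1)`**, the leaf-closed strengthening of (HCOV). -/
def HCovPlus (o a₁ a₂ a₃ b : V) : Prop :=
  HCov p ends o a₁ a₂ a₃ b ∧ Q1Row p ends o a₁ a₂ a₃ b

end Defs

/-! ## The pole identity -/

section Identity

variable (p : E → R) (ends : E → Sym2 V)

omit [Fintype V] in
/-- **THE POLE IDENTITY**: `2 · P(Q) · D_v · R½ = D_v² · T₀ + P(Q)² · Gc(v) + CovC(o, v) · T₀(b, v)`,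
`D_v = P(PD_v) = P(Q, v ∉ U)`. -/
theorem Rhalf_pole_identity (o a₁ a₂ v b : V) :
    2 * prob p (avoidAll ends a₂ {a₁}) * prob p (PDEvent ends a₁ a₂ v) *
        Rhalf p ends o a₁ a₂ v b =
      prob p (PDEvent ends a₁ a₂ v) ^ 2 * T0 p ends o a₁ a₂ b +
        prob p (avoidAll ends a₂ {a₁}) ^ 2 * Gc p ends o a₁ a₂ v b +
        covC p ends o a₁ a₂ v * T0 p ends b a₁ a₂ v := by
  unfold Rhalf T0 Gc1 covC mU mUU
  unfold Gc DEF EQbo EQb3 EQb3o EQo EQ3 EQ3o PDb PDbo Do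
  rw [gap_eq_Q p ends a₁ a₂ b, gap_eq_Q p ends a₁ a₂ v]
  simp only [prob_PD_v p ends a₁ a₂ v, prob_T_v p ends a₁ a₂ v, prob_T'_v p ends a₁ a₂ v,
    prob_PD_inter_v p ends a₁ a₂ v, prob_T_inter_v p ends a₁ a₂ v, prob_T'_inter_v p ends a₁ a₂ v]
  simp only [Set.inter_comm, Set.inter_left_comm]
  ring

end Identity

/-! ## The leaf row from (Q1) -/

section Row

variable (p : E → R) (ends : E → Sym2 V)

/-- **2′LEAF at `v` from (HCOV)⁺-data at `v`**: if `D_v > 0` then `0 ≤ T₀` and (Q1) at `a₃ := v`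
give `0 ≤ R½`. -/
theorem leafRow_of_Q1 (hp : IsProbVec p) (o a₁ a₂ v b : V)
    (hD : 0 < prob p (PDEvent ends a₁ a₂ v)) (hQ1 : Q1Row p ends o a₁ a₂ v b) :
    LeafRow p ends o a₁ a₂ v b := by
  unfold LeafRow
  unfold Q1Row at hQ1
  have hid := Rhalf_pole_identity p ends o a₁ a₂ v b
  have hT0 := T0_nonneg p ends hp o a₁ a₂ b
  have hPD : PDEvent ends a₁ a₂ v ⊆ avoidAll ends a₂ {a₁} := by
    intro ω hω
    rw [ISplit.PD_eq_R_inter] at hω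
    have hR := hω.1
    rw [ZOloc.R_eq_Q_inter] at hR
    exact hR.1
  have hP : 0 < prob p (avoidAll ends a₂ {a₁}) := lt_of_lt_of_le hD (prob_mono hp hPD)
  have hpos : 0 < 2 * prob p (avoidAll ends a₂ {a₁}) * prob p (PDEvent ends a₁ a₂ v) := by
    positivity
  have hrhs : 0 ≤ prob p (PDEvent ends a₁ a₂ v) ^ 2 * T0 p ends o a₁ a₂ b +
      prob p (avoidAll ends a₂ {a₁}) ^ 2 * Gc p ends o a₁ a₂ v b +
        covC p ends o a₁ a₂ v * T0 p ends b a₁ a₂ v := by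
    have := mul_nonneg (sq_nonneg (prob p (PDEvent ends a₁ a₂ v))) hT0
    linarith
  rw [← hid] at hrhs
  exact (mul_nonneg_iff_of_pos_left hpos).1 hrhs

end Row

/-! ## The leaf atoms of `CovC` and `T₀(b, ·)` -/

section LeafAtoms

variable (p : E → R) (ends : E → Sym2 V)

omit [Fintype V] [DecidableEq V] [LinearOrder R] [IsStrictOrderedRing R] in
/-- `P(Q ∩ (X ∩ {a₃ ∈ C₁})) = q · P(Q ∩ (X ∩ {v ∈ C₁}))` for a leaf `a₃` at `v` and free `X`. -/
lemma prob_Q_inter_conn₁_leaf {f : E} {a₃ v : V} (hf : ends f = s(a₃, v))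
    (hleaf : ∀ e, a₃ ∈ ends e → e = f) (h3v : a₃ ≠ v) {a₁ a₂ : V} (h31 : a₃ ≠ a₁) (h32 : a₃ ≠ a₂)
    {X : Set (Config E)} (hX : Free f X) :
    prob p (avoidAll ends a₂ {a₁} ∩ (X ∩ connEvent ends a₁ a₃)) =
      p f * prob p (avoidAll ends a₂ {a₁} ∩ (X ∩ connEvent ends a₁ v)) := by
  rw [Set.inter_comm X (connEvent ends a₁ a₃), ← prob_T'_inter_v p ends a₁ a₂ a₃ X,
    prob_T'_inter_o p hf hleaf h3v h31 h32 hX, Set.inter_comm (connEvent ends a₁ v) X]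

omit [Fintype V] [DecidableEq V] [LinearOrder R] [IsStrictOrderedRing R] in
/-- `P(Q ∩ (X ∩ {a₃ ∈ C₂})) = q · P(Q ∩ (X ∩ {v ∈ C₂}))` for a leaf `a₃` at `v` and free `X`. -/
lemma prob_Q_inter_conn₂_leaf {f : E} {a₃ v : V} (hf : ends f = s(a₃, v))
    (hleaf : ∀ e, a₃ ∈ ends e → e = f) (h3v : a₃ ≠ v) {a₁ a₂ : V} (h31 : a₃ ≠ a₁) (h32 : a₃ ≠ a₂)
    {X : Set (Config E)} (hX : Free f X) :
    prob p (avoidAll ends a₂ {a₁} ∩ (X ∩ connEvent ends a₂ a₃)) =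
      p f * prob p (avoidAll ends a₂ {a₁} ∩ (X ∩ connEvent ends a₂ v)) := by
  rw [Set.inter_comm X (connEvent ends a₂ a₃), ← prob_T_inter_v p ends a₁ a₂ a₃ X,
    prob_T_inter_o p hf hleaf h3v h31 h32 hX, Set.inter_comm (connEvent ends a₂ v) X]

omit [Fintype V] [DecidableEq V] [LinearOrder R] [IsStrictOrderedRing R] in
/-- `P(Q ∩ {a₃ ∈ C₁}) = q · P(Q ∩ {v ∈ C₁})`. -/
lemma prob_Q_conn₁_leaf' {f : E} {a₃ v : V} (hf : ends f = s(a₃, v))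
    (hleaf : ∀ e, a₃ ∈ ends e → e = f) (h3v : a₃ ≠ v) {a₁ a₂ : V} (h31 : a₃ ≠ a₁) (h32 : a₃ ≠ a₂) :
    prob p (avoidAll ends a₂ {a₁} ∩ connEvent ends a₁ a₃) =
      p f * prob p (avoidAll ends a₂ {a₁} ∩ connEvent ends a₁ v) := by
  rw [← prob_T'_v p ends a₁ a₂ a₃, prob_T'_o p hf hleaf h3v h31 h32]

omit [Fintype V] [DecidableEq V] [LinearOrder R] [IsStrictOrderedRing R] in
/-- `P(Q ∩ {a₃ ∈ C₂}) = q · P(Q ∩ {v ∈ C₂})`. -/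
lemma prob_Q_conn₂_leaf' {f : E} {a₃ v : V} (hf : ends f = s(a₃, v))
    (hleaf : ∀ e, a₃ ∈ ends e → e = f) (h3v : a₃ ≠ v) {a₁ a₂ : V} (h31 : a₃ ≠ a₁) (h32 : a₃ ≠ a₂) :
    prob p (avoidAll ends a₂ {a₁} ∩ connEvent ends a₂ a₃) =
      p f * prob p (avoidAll ends a₂ {a₁} ∩ connEvent ends a₂ v) := by
  rw [← prob_T_v p ends a₁ a₂ a₃, prob_T_o p hf hleaf h3v h31 h32]

omit [Fintype V] [DecidableEq V] [LinearOrder R] [IsStrictOrderedRing R] in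
/-- **`CovC` is linear in the leaf weight**: `CovC(o, a₃) = q · CovC(o, v)`. -/
theorem covC_leaf {f : E} {a₃ v : V} (hf : ends f = s(a₃, v)) (hleaf : ∀ e, a₃ ∈ ends e → e = f)
    (h3v : a₃ ≠ v) {o a₁ a₂ : V} (h31 : a₃ ≠ a₁) (h32 : a₃ ≠ a₂) (ho : o ≠ a₃) :
    covC p ends o a₁ a₂ a₃ = p f * covC p ends o a₁ a₂ v := by
  have c₁o := free_connEvent hf hleaf h3v (Ne.symm h31) ho
  have c₂o := free_connEvent hf hleaf h3v (Ne.symm h32) ho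
  unfold covC mUU mU
  rw [prob_Q_inter_conn₁_leaf p ends hf hleaf h3v h31 h32 c₁o,
    prob_Q_inter_conn₂_leaf p ends hf hleaf h3v h31 h32 c₂o,
    prob_Q_inter_conn₁_leaf p ends hf hleaf h3v h31 h32 c₂o,
    prob_Q_inter_conn₂_leaf p ends hf hleaf h3v h31 h32 c₁o,
    prob_Q_conn₁_leaf' p ends hf hleaf h3v h31 h32, prob_Q_conn₂_leaf' p ends hf hleaf h3v h31 h32]
  ring

omit [Fintype V] [DecidableEq V] in
/-- **`T₀(b, ·)` is linear in the leaf weight**: `T₀(b, a₃) = q · T₀(b, v)`. -/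
theorem T0_leaf {f : E} {a₃ v : V} (hf : ends f = s(a₃, v)) (hleaf : ∀ e, a₃ ∈ ends e → e = f)
    (h3v : a₃ ≠ v) {a₁ a₂ b : V} (h31 : a₃ ≠ a₁) (h32 : a₃ ≠ a₂) (hb : b ≠ a₃) :
    T0 p ends b a₁ a₂ a₃ = p f * T0 p ends b a₁ a₂ v := by
  have c₁b := free_connEvent hf hleaf h3v (Ne.symm h31) hb
  have c₂b := free_connEvent hf hleaf h3v (Ne.symm h32) hb
  unfold T0 EQbo EQo mUU mU
  rw [gap_eq_Q p ends a₁ a₂ a₃, gap_eq_Q p ends a₁ a₂ v]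
  rw [prob_Q_inter_conn₁_leaf p ends hf hleaf h3v h31 h32 c₁b,
    prob_Q_inter_conn₂_leaf p ends hf hleaf h3v h31 h32 c₂b,
    prob_Q_inter_conn₁_leaf p ends hf hleaf h3v h31 h32 c₂b,
    prob_Q_inter_conn₂_leaf p ends hf hleaf h3v h31 h32 c₁b,
    prob_Q_conn₁_leaf' p ends hf hleaf h3v h31 h32, prob_Q_conn₂_leaf' p ends hf hleaf h3v h31 h32]
  ring

end LeafAtoms

/-! ## The leaf closure of `(HCOV)⁺` -/

section Closure

variable (p : E → R) (ends : E → Sym2 V)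

omit [Fintype V] in
/-- **(Q1) propagates to a leaf**: `0 ≤ T₀`, `0 ≤ R½` and (Q1) at the marker `v` give (Q1) at a
leaf `a₃` attached to `v` (every leaf weight). -/
theorem Q1Row_leaf (hp : IsProbVec p) {f : E} {a₃ v : V} (hf : ends f = s(a₃, v))
    (hleaf : ∀ e, a₃ ∈ ends e → e = f) (h3v : a₃ ≠ v) {o a₁ a₂ b : V} (h31 : a₃ ≠ a₁)
    (h32 : a₃ ≠ a₂) (ho : o ≠ a₃) (hb : b ≠ a₃) (hT0 : 0 ≤ T0 p ends o a₁ a₂ b)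
    (hrow : LeafRow p ends o a₁ a₂ v b) (hQ1 : Q1Row p ends o a₁ a₂ v b) :
    Q1Row p ends o a₁ a₂ a₃ b := by
  unfold Q1Row at hQ1 ⊢
  unfold LeafRow at hrow
  rw [Gc_leaf p ends hf hleaf h3v h31 h32 ho hb, covC_leaf p ends hf hleaf h3v h31 h32 ho,
    T0_leaf p ends hf hleaf h3v h31 h32 hb]
  have hq0 := hp.nonneg f
  have h1q : 0 ≤ 1 - p f := sub_nonneg.2 (hp.le_one f)
  have hP2 : 0 ≤ prob p (avoidAll ends a₂ {a₁}) ^ 2 := sq_nonneg _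
  have e : prob p (avoidAll ends a₂ {a₁}) ^ 2 *
        ((1 - p f) ^ 2 * T0 p ends o a₁ a₂ b + 2 * p f * (1 - p f) * Rhalf p ends o a₁ a₂ v b +
          p f ^ 2 * Gc p ends o a₁ a₂ v b) +
      p f * covC p ends o a₁ a₂ v * (p f * T0 p ends b a₁ a₂ v) =
    (1 - p f) ^ 2 * (prob p (avoidAll ends a₂ {a₁}) ^ 2 * T0 p ends o a₁ a₂ b) +
      2 * p f * (1 - p f) * (prob p (avoidAll ends a₂ {a₁}) ^ 2 * Rhalf p ends o a₁ a₂ v b) +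
      p f ^ 2 * (prob p (avoidAll ends a₂ {a₁}) ^ 2 * Gc p ends o a₁ a₂ v b +
        covC p ends o a₁ a₂ v * T0 p ends b a₁ a₂ v) := by ring
  rw [e]
  have t0 : 0 ≤ (1 - p f) ^ 2 := sq_nonneg _
  have t1 : 0 ≤ 2 * p f * (1 - p f) := mul_nonneg (mul_nonneg (by norm_num) hq0) h1q
  have t2 : 0 ≤ p f ^ 2 := sq_nonneg _
  exact add_nonneg (add_nonneg (mul_nonneg t0 (mul_nonneg hP2 hT0))
    (mul_nonneg t1 (mul_nonneg hP2 hrow))) (mul_nonneg t2 hQ1)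

/-- **THE LEAF CLOSURE OF (HCOV)⁺**: `(HCOV) ∧ (Q1)` at the marker `v` (with `P(Q, v ∉ U) > 0`)
gives `(HCOV) ∧ (Q1)` at a leaf `a₃` attached to `v`, for every leaf weight — and the leaf row
`0 ≤ R½` at `v` on the way. -/
theorem HCovPlus_leaf (hp : IsProbVec p) {f : E} {a₃ v : V} (hf : ends f = s(a₃, v))
    (hleaf : ∀ e, a₃ ∈ ends e → e = f) (h3v : a₃ ≠ v) {o a₁ a₂ b : V} (h31 : a₃ ≠ a₁)
    (h32 : a₃ ≠ a₂) (ho : o ≠ a₃) (hb : b ≠ a₃) (hD : 0 < prob p (PDEvent ends a₁ a₂ v))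
    (hv : HCovPlus p ends o a₁ a₂ v b) :
    HCovPlus p ends o a₁ a₂ a₃ b ∧ LeafRow p ends o a₁ a₂ v b := by
  obtain ⟨hHv, hQv⟩ := hv
  have hrow := leafRow_of_Q1 p ends hp o a₁ a₂ v b hD hQv
  have hT0 := T0_nonneg p ends hp o a₁ a₂ b
  exact ⟨⟨HCov_leaf p ends hp hf hleaf h3v h31 h32 ho hb hHv hrow,
    Q1Row_leaf p ends hp hf hleaf h3v h31 h32 ho hb hT0 hrow hQv⟩, hrow⟩

/-- **2′LEAF at `v` from (HCOV)⁺ at `v`** (with `P(Q, v ∉ U) > 0`). -/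
theorem leafRow_of_HCovPlus (hp : IsProbVec p) (o a₁ a₂ v b : V)
    (hD : 0 < prob p (PDEvent ends a₁ a₂ v)) (hv : HCovPlus p ends o a₁ a₂ v b) :
    LeafRow p ends o a₁ a₂ v b :=
  leafRow_of_Q1 p ends hp o a₁ a₂ v b hD hv.2

end Closure

end LeafStep

end Summit.Ventures.PercRepro2
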